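import Mathlib
import Summits.ResolutionOfSingularities.ResolutionOfSingularities.Theorems.RadicialJungCleanModelsCleanProp44SigmaTowerEnds
import Summits.ResolutionOfSingularities.ResolutionOfSingularities.Theorems.RadicialJungCleanModelsCleanProp44TowerFaceFinite
import HarnessLib

/-!
# Route `RadicialJung`, crux `CleanModels` (stmt-ResolutionOfSingularities-15917), line `Sketch` rev 35, stub 6 `stub_cleanProp44` (X44c):
# STEP 1 OF THE `δ`-DESCENT END TO END ON THE σ-TOWER — ✓ `sigmaTower` ∘ ✓ `tower_face_of_lt` ∘ ✓ `exists_successor_of_exists_isLocalization`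

Seat decomp-res-hand-2 g23 (structural hand).  KERNEL CHECK THAT THE PIECES FIT: on an honest finite σ-tower (levels `0, …, d+1`, data and hypotheses of
✓ `sigmaTower` with `K = κ(c)[u]`), the leaf-tower data of ✓ `tower_face_of_lt` (controlled transforms `f_j`, coefficients `h_{j,e}`, first chart `τ_R, uf`,
initial forms `G_e`, residue map `σ`, linear coordinates `y`), the cocone taken to be THE QUOTIENT MAP `ε = (𝒪_{d+1} → 𝒪_{d+1}/(v_{d+1}))` with
`ε₀ = ε ∘ Ψ_{d+1}` (so the cocone bookkeeping `hθh`, `hθv` FOLLOWS from the tower relations), ANY `κ[u][T]`-structure on `S = 𝒪_{d+1}/(v_{d+1})` compatible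
with the base (`C g ↦ class of Ψ_{d+1} r₀`, `T ↦ t̄_{d+1}`), two level-`0` compatibilities (`C(σ r) ↦ class of τ_R r`, `y_i ↦ class of uf_i`), and the
generic-point data of the near curve (`g(u) ≠ 0` units, `𝔫_S ∩ κ[u][T] ≠ 0`, `f̄_{d+1} ∈ 𝔫_S^μ` — census (S3)):

* `comp_eq_of_tower` / `comp_v_eq_of_tower` — `h_{j,e} = Ψ_j h_{0,e}` and `Ψ_j v_0 = v_j` below the top (the cocone facts for `ε₀ = ε ∘ Ψ`).
* `sigmaTower_successor` — **STEP 1 END TO END**: the near curve through the top point is `π = a(T + λ)`, `𝔫_S ∩ κ[u][T] = (π)`, the face is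
  `Φ = c(T + λ)^μ` with `c = σ(G_μ(0)) ≠ 0`, `deg λ ≤ d + 2`, `deg λ′ ≤ d`, and `f̄_{d+1} = Φ` in `S`.

Honest framing: OURS, composition only — every ingredient is a landed theorem; what the termination author still supplies is the INSTANTIATION (the
blowings up, the points, `e_j = stalkCongr`, the leaf data, (S3), (S4)) and STEP 2 at the births (✓ `birth_descent_of_exists_isLocalization`, one closed-point
tower per birth); nothing here proves X44c, any case of `CleanModels`, or resolution of singularities in characteristic `p`.
[cite: CossartPiltant2008, Lemma 4.3 (5); Prop. 4.4 (proof, p. 11)] [cite: CossartJannsenSaito2020, Lemma 7.5] [cite: StacksProject, Tag 0804, Tag 0BIQ]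
-/

noncomputable section

set_option linter.dupNamespace false -- mandated namespace of this single-conjunct summit

open IsLocalRing CategoryTheory AlgebraicGeometry Polynomial
open Literature.AlgebraicGeometry.Resolution

namespace Summit.ResolutionOfSingularities.ResolutionOfSingularities.Theorems.RadicialJung.CleanModels

universe u

/-! ## §1 Composites along the tower -/

section Composites

variable (Aj : ℕ → Type*) [∀ j, CommRing (Aj j)] (ψ : ∀ j, Aj j →+* Aj (j + 1)) (d : ℕ)
  (Ψ : ∀ j, Aj 0 →+* Aj j) (hΨ0 : ∀ r, Ψ 0 r = r) (hΨ : ∀ j < d, ∀ r, Ψ (j + 1) r = ψ j (Ψ j r))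

include hΨ0 hΨ

/-- A family compatible below `d` (`x_{j+1} = ψ_j x_j`) is the composite image of its bottom: `x_j = Ψ_j x_0` for `j ≤ d`. [folklore] -/
theorem comp_eq_of_tower (x : ∀ j, Aj j) (hx : ∀ j < d, x (j + 1) = ψ j (x j)) : ∀ j ≤ d, x j = Ψ j (x 0) := by
  intro j
  induction j with
  | zero => intro _; rw [hΨ0]
  | succ j ih => intro hj; rw [hx j (by omega), ih (by omega), ← hΨ j (by omega)]

/-- In particular `Ψ_j v_0 = v_j` for the exceptional parameters (`ψ_j v_j = v_{j+1}`). [folklore] -/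
theorem comp_v_eq_of_tower (v : ∀ j, Aj j) (hv : ∀ j < d, ψ j (v j) = v (j + 1)) : ∀ j ≤ d, Ψ j (v 0) = v j :=
  fun j hj => (comp_eq_of_tower Aj ψ d Ψ hΨ0 hΨ v (fun j hj => (hv j hj).symm) j hj).symm

end Composites

/-! ## §2 STEP 1 end to end -/

section Successor

variable (d : ℕ) (Y : ℕ → Scheme.{u}) (τ : ∀ j, Y (j + 1) ⟶ Y j) (J : ∀ j, (Y j).IdealSheafData) (y : ∀ j, Y (j + 1))
  (e : ∀ j, (Y (j + 1)).presheaf.stalk (y j) ≃+* (Y (j + 1)).presheaf.stalk (τ (j + 1) (y (j + 1))))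
  (ψ : ∀ j, (Y j).presheaf.stalk (τ j (y j)) →+* (Y (j + 1)).presheaf.stalk (τ (j + 1) (y (j + 1))))
  (t v : ∀ j, (Y j).presheaf.stalk (τ j (y j)))
  {k : Type u} [Field k] (M₀ : Submonoid k[X])
  (Ψ : ∀ j, (Y 0).presheaf.stalk (τ 0 (y 0)) →+* (Y j).presheaf.stalk (τ j (y j)))
  (inst₀ : Algebra k[X] ((Y 0).presheaf.stalk (τ 0 (y 0)) ⧸ Ideal.span (Set.range ![t 0, v 0])))
  (μ : ℕ) (f : ∀ j, (Y j).presheaf.stalk (τ j (y j))) (h : ∀ j, ℕ → (Y j).presheaf.stalk (τ j (y j)))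
  {R : Type*} [CommRing R] {σι : Type*} [Fintype σι] (τR : R →+* (Y 0).presheaf.stalk (τ 0 (y 0)))
  (uf : σι → (Y 0).presheaf.stalk (τ 0 (y 0))) (G : ℕ → MvPolynomial σι R) (σ : R →+* k) (yv : σι → k[X])
  (instE : Algebra (k[X])[X] ((Y (d + 1)).presheaf.stalk (τ (d + 1) (y (d + 1))) ⧸ Ideal.span {v (d + 1)}))

set_option maxHeartbeats 800000 in
-- long statement; elaboration only
/-- **STEP 1 OF THE `δ`-DESCENT END TO END ON THE σ-TOWER** (see the module docstring for the data; the tower has top level `d + 1`, so `δ = d + 2`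
divisions and `p ∣ δ` reads `((d + 2 : ℕ) : κ) = 0`).  Conclusion: a prime `π = a(T + λ)` with `𝔫_S ∩ κ[u][T] = (π)` (the near curve `Γ″` through the top
point), `Φ = c(T + λ)^μ`, `deg λ ≤ d + 2`, `deg λ′ ≤ d`, and `f̄_{d+1} = Φ` in `S = 𝒪_{d+1}/(v_{d+1})`.
[cite: CossartPiltant2008, Lemma 4.3 (5); Prop. 4.4 (proof, p. 11)] [cite: CossartJannsenSaito2020, Lemma 7.5] -/
theorem sigmaTower_successor
    -- the σ-tower (✓ `sigmaTower` with `K = κ[u]`, top level `d + 1`)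
    (hτ : ∀ j < d + 1, IsBlowup (τ j) (J j)) (hψ : ∀ j < d + 1, ∀ r, ψ j r = e j (((τ j).stalkMap (y j)).hom r))
    (h0 : IsRsopPart ![t 0, v 0]) (hcJ : ∀ j < d + 1, Ideal.span (Set.range ![t j, v j]) = stalkIdeal (J j) (τ j (y j)))
    (hv : ∀ j < d + 1, ψ j (v j) = v (j + 1)) (ht : ∀ j < d + 1, ψ j (t j) = v (j + 1) * t (j + 1))
    (ht𝔪 : ∀ j < d + 1, t (j + 1) ∈ maximalIdeal ((Y (j + 1)).presheaf.stalk (τ (j + 1) (y (j + 1)))))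
    (hΨ0 : ∀ r, Ψ 0 r = r) (hΨ : ∀ j < d + 1, ∀ r, Ψ (j + 1) r = ψ j (Ψ j r))
    (hloc₀ : @IsLocalization k[X] _ M₀ ((Y 0).presheaf.stalk (τ 0 (y 0)) ⧸ Ideal.span (Set.range ![t 0, v 0])) _ inst₀)
    -- the leaf tower (✓ `tower_face_of_lt` with its `d := d + 1`)
    (hf : ∀ j < d + 1, v (j + 1) ^ μ * f (j + 1) = ψ j (f j)) (hh : ∀ j < d + 1, ∀ e', h (j + 1) e' = ψ j (h j e'))
    (h0f : f 0 = ∑ e' ∈ Finset.range (μ + 1), t 0 ^ e' * v 0 ^ ((μ - e') * (d + 1)) * h 0 e')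
    (hG : ∀ e', (G e').IsHomogeneous ((μ - e') * (d + 1 + 1)))
    (hh0 : ∀ e' ≤ μ, h 0 e' - MvPolynomial.eval₂ τR uf (G e') ∈ Ideal.span {v 0})
    -- level-`0` compatibilities of the base structure with the first chart
    (hΛC : ∀ r, @algebraMap k[X] ((Y 0).presheaf.stalk (τ 0 (y 0)) ⧸ Ideal.span (Set.range ![t 0, v 0])) _ _ inst₀ (C (σ r)) =
      Ideal.Quotient.mk _ (τR r))
    (hΛy : ∀ i, @algebraMap k[X] ((Y 0).presheaf.stalk (τ 0 (y 0)) ⧸ Ideal.span (Set.range ![t 0, v 0])) _ _ inst₀ (yv i) =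
      Ideal.Quotient.mk _ (uf i))
    (hy1 : ∀ i, (yv i).natDegree ≤ 1)
    -- the `κ[u][T]`-structure on `S = 𝒪_{d+1}/(v_{d+1})`, compatible with the base
    (hEC : ∀ (g : k[X]) (r₀ : (Y 0).presheaf.stalk (τ 0 (y 0))),
      @algebraMap k[X] ((Y 0).presheaf.stalk (τ 0 (y 0)) ⧸ Ideal.span (Set.range ![t 0, v 0])) _ _ inst₀ g = Ideal.Quotient.mk _ r₀ →
      @algebraMap (k[X])[X] ((Y (d + 1)).presheaf.stalk (τ (d + 1) (y (d + 1))) ⧸ Ideal.span {v (d + 1)}) _ _ instE (C g) =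
        Ideal.Quotient.mk _ (Ψ (d + 1) r₀))
    (hEX : @algebraMap (k[X])[X] ((Y (d + 1)).presheaf.stalk (τ (d + 1) (y (d + 1))) ⧸ Ideal.span {v (d + 1)}) _ _ instE Polynomial.X =
      Ideal.Quotient.mk _ (t (d + 1)))
    [IsLocalRing ((Y (d + 1)).presheaf.stalk (τ (d + 1) (y (d + 1))) ⧸ Ideal.span {v (d + 1)})]
    -- Case II, `p ∣ δ`, and the generic point of the near curve (census (S3))
    (hμ : 1 ≤ μ) (hc : σ (MvPolynomial.coeff 0 (G μ)) ≠ 0) (hδ : ((d + 1 + 1 : ℕ) : k) = 0)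
    (hCu : ∀ g : k[X], g ≠ 0 →
      IsUnit (@algebraMap (k[X])[X] ((Y (d + 1)).presheaf.stalk (τ (d + 1) (y (d + 1))) ⧸ Ideal.span {v (d + 1)}) _ _ instE (C g)))
    (hne : (maximalIdeal ((Y (d + 1)).presheaf.stalk (τ (d + 1) (y (d + 1))) ⧸ Ideal.span {v (d + 1)})).comap
      (@algebraMap (k[X])[X] ((Y (d + 1)).presheaf.stalk (τ (d + 1) (y (d + 1))) ⧸ Ideal.span {v (d + 1)}) _ _ instE) ≠ ⊥)
    (hΦ : Ideal.Quotient.mk (Ideal.span {v (d + 1)}) (f (d + 1)) ∈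
      maximalIdeal ((Y (d + 1)).presheaf.stalk (τ (d + 1) (y (d + 1))) ⧸ Ideal.span {v (d + 1)}) ^ μ) :
    ∃ (π : (k[X])[X]) (a : k) (lam : k[X]), Prime π ∧
      (maximalIdeal ((Y (d + 1)).presheaf.stalk (τ (d + 1) (y (d + 1))) ⧸ Ideal.span {v (d + 1)})).comap
        (@algebraMap (k[X])[X] ((Y (d + 1)).presheaf.stalk (τ (d + 1) (y (d + 1))) ⧸ Ideal.span {v (d + 1)}) _ _ instE) = Ideal.span {π} ∧
      a ≠ 0 ∧ π = C (C a) * (X + C lam) ∧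
      (∑ e' ∈ Finset.range (μ + 1), (X : (k[X])[X]) ^ e' * C (MvPolynomial.eval₂ ((C : k →+* k[X]).comp σ) yv (G e'))) =
        C (C (σ (MvPolynomial.coeff 0 (G μ)))) * (X + C lam) ^ μ ∧
      lam.natDegree ≤ d + 1 + 1 ∧ (derivative lam).natDegree ≤ d + 1 + 1 - 2 ∧
      Ideal.Quotient.mk (Ideal.span {v (d + 1)}) (f (d + 1)) =
        @algebraMap (k[X])[X] ((Y (d + 1)).presheaf.stalk (τ (d + 1) (y (d + 1))) ⧸ Ideal.span {v (d + 1)}) _ _ instE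
          (C (C (σ (MvPolynomial.coeff 0 (G μ)))) * (X + C lam) ^ μ) := by
  letI := instE
  -- the tower: `hvnzd` at every level and the `K[T]`-localization of `S` at the top
  have htower := sigmaTower (d + 1) Y τ J y e ψ t v M₀ Ψ inst₀ hτ hψ h0 hcJ hv ht ht𝔪 hΨ0 hΨ hloc₀
  have hvnzd : ∀ j < d + 1, v (j + 1) ∈ nonZeroDivisors ((Y (j + 1)).presheaf.stalk (τ (j + 1) (y (j + 1)))) :=
    fun j hj => (htower j hj).2.1
  obtain ⟨-, -, -, -, -, -, -, -, hE⟩ := htower d (lt_add_one d)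
  have hN := hE instE hEC hEX
  -- the cocone `ε = mk`, `ε₀ = mk ∘ Ψ_{d+1}`
  have hhd : ∀ e' ≤ μ, Ideal.Quotient.mk (Ideal.span {v (d + 1)}) (h (d + 1) e') =
      ((Ideal.Quotient.mk (Ideal.span {v (d + 1)})).comp (Ψ (d + 1))) (h 0 e') := fun e' _ => by
    rw [RingHom.comp_apply,
      comp_eq_of_tower (fun j => (Y j).presheaf.stalk (τ j (y j))) ψ (d + 1) Ψ hΨ0 hΨ (fun j => h j e') (fun j hj => hh j hj e') (d + 1) le_rfl]
  have hv0 : ((Ideal.Quotient.mk (Ideal.span {v (d + 1)})).comp (Ψ (d + 1))) (v 0) = 0 := by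
    rw [RingHom.comp_apply, comp_v_eq_of_tower (fun j => (Y j).presheaf.stalk (τ j (y j))) ψ (d + 1) Ψ hΨ0 hΨ v hv (d + 1) le_rfl,
      Ideal.Quotient.eq_zero_iff_mem]
    exact Ideal.mem_span_singleton_self _
  have hεv : Ideal.Quotient.mk (Ideal.span {v (d + 1)}) (v (d + 1)) = 0 :=
    Ideal.Quotient.eq_zero_iff_mem.mpr (Ideal.mem_span_singleton_self _)
  have hσ : ∀ r, ((Ideal.Quotient.mk (Ideal.span {v (d + 1)})).comp (Ψ (d + 1))) (τR r) =
      algebraMap (k[X])[X] _ (C (C (σ r))) := fun r => by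
    rw [RingHom.comp_apply, hEC (C (σ r)) (τR r) (hΛC r)]
  have hy : ∀ i, ((Ideal.Quotient.mk (Ideal.span {v (d + 1)})).comp (Ψ (d + 1))) (uf i) = algebraMap (k[X])[X] _ (C (yv i)) := fun i => by
    rw [RingHom.comp_apply, hEC (yv i) (uf i) (hΛy i)]
  -- the face
  obtain ⟨hface, hdeg, htop, hC0⟩ := tower_face_of_lt (fun j => (Y j).presheaf.stalk (τ j (y j))) ψ μ (d + 1) t v f h τR uf G
    ((Ideal.Quotient.mk (Ideal.span {v (d + 1)})).comp (Ψ (d + 1))) (Ideal.Quotient.mk (Ideal.span {v (d + 1)})) σ yv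
    hv hvnzd ht hf hh h0f hG hh0 hhd hv0 hεv hEX.symm hσ hy hy1
  -- STEP 1 at the generic point
  have hΦ' : algebraMap (k[X])[X] ((Y (d + 1)).presheaf.stalk (τ (d + 1) (y (d + 1))) ⧸ Ideal.span {v (d + 1)})
      (∑ e' ∈ Finset.range (μ + 1), (X : (k[X])[X]) ^ e' * C (MvPolynomial.eval₂ ((C : k →+* k[X]).comp σ) yv (G e'))) ∈
      maximalIdeal _ ^ μ := by rw [← hface]; exact hΦ
  obtain ⟨π, a, lam, hπ, hcomap, ha, hπeq, hΦeq, hlam, hlam'⟩ :=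
    exists_successor_of_exists_isLocalization hN hCu hne hμ hdeg hc htop hC0 hδ hΦ'
  exact ⟨π, a, lam, hπ, hcomap, ha, hπeq, hΦeq, hlam, hlam', by rw [hface, hΦeq]⟩

end Successor

end Summit.ResolutionOfSingularities.ResolutionOfSingularities.Theorems.RadicialJung.CleanModels

end
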